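import Literature.MathematicalPhysics.QuantumFieldTheory.Balaban1983to89.B5Eq117TorusCarriers
import Literature.MathematicalPhysics.QuantumFieldTheory.Balaban1983to89.B5Prop12FieldsLattice
import Literature.MathematicalPhysics.QuantumFieldTheory.Balaban1983to89.T3ContinuumYM3Torus
import HarnessLib

/-!
# Route `UnitScaleTilt`, crux K1 «MinimiserStabilityRegPr» (stmt-QuantumFields-19200), leaf `stub_halvingStep` — the (P2-small) branch by COVERING
# (★★OWNER RULING g26-№18 (α), brick α1): **THE `L^{jc}`-FOLD COVERING TORUS AND ITS COVERING MAP — sites, bonds, plaquettes, blocks, fibres, distances**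

Cell `ym3-torus` (HUMAN RULING D-0037, YM ladder rung R3 — continuum SU(2) YM₃ on the torus is a RUNG, not the Clay problem), explicit-unit helper seat
`ym-ust-19936-w8` gen 0, row α1 of RULING g26-№18 (C), typed from LEAD `ym-ust-19200-w5` g3's signature sheet `alpha1-CoverSites-SIGNATURES.lean.md`
(decl names kept verbatim — α2–α5 type against them).  Definitions lane; `--supports stmt-QuantumFields-19200 --as helper`; counts toward nothing by itself.

WHY (LEAD's H-SMALL plan, RULING №18 (A)).  The halving step's P2 suppliers carry a torus-size floor (`chart_params (hsize : a′+3 ≤ m+n)`); a member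
`(m, n, K)` below the floor is LIFTED to its `L^{jc}`-fold cover `(m+jc, n, K)` — same `d, L, K`, volume exponent `m + jc` — along the coordinatewise reduction
`π : ZMod (2L^{m+jc+K−i}) → ZMod (2L^{m+K−i})` at every level `i` («wrap-around is harmless»: unwrap to the cover, where the cube sequence fits).  This file is
the lattice-geometric layer of that lift: `π` is a homomorphism of the lattice GRAPH (shifts, blocks, block centres, iterated blocks commute with it; NO
injectivity is used anywhere), its fibres have the `K`-FREE cardinality `(L^{jc})^d`, sums over the cover regroup over fibres, and the circular sup-distance
can only shrink under `π` and is attained on a lift.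

WHAT IS DEFINED ∕ PROVED (namespace `…Theorems.CoverSites`; all proofs are `ZMod.val`∕`Nat.mod`∕`Nat.div` arithmetic).
* §1 `cover P jc : Params` (`d, L, K` unchanged, `m ↦ m + jc`), `sitesPerDir_dvd`, `sitesPerDir_cover_eq` (`= · L^{jc}` in the standing range `i ≤ m+K`).
* §2 `proj P jc i : Site (cover P jc) i → Site P i` (coordinatewise `ZMod.castHom`), `proj_apply`, `val_proj`, `val_proj_div`, `proj_surjective`, `proj_zero`.
* §3 graph structure: `proj_shift`, `proj_unshift`, `proj_add_ker` (deck translations), `proj_blockOf`, `proj_emb`, `proj_iterBlockOf`, `mem_block_proj`.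
* §4 bonds and plaquettes: `projBond`, `projBond_src`∕`_dir`∕`_tgt`, `projBond_surjective`, `projPlaq`.
* §5 fibres: `card_fibre_coord` (`L^{jc}` per coordinate), ★`card_fibre_site`, ★`card_fibre_bond` (`(L^{jc})^d`), `sum_cover_eq_sum_fibre`.
* §6 distances: ★`distSite_proj_le`, ★`exists_lift_distSite_eq`.
* §7 the T³ reading: `T3Family.cover` (a member's cover is a member with the same `L`), `T3Family.cover_P` (`rfl`), `T3Family.cover_L`.
HONEST SCOPE: pure finite-torus bookkeeping; no analysis, no gauge fields; `K` enters no cardinality (kill test k-iv of the plan).  NOT a claim about the mass gap.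

References: T. Bałaban, CMP **102** (1985) 277–309 [Balaban1985Variational] ((144) p.300 — the cube sequence on the torus; Thm 1 p.279 quantifies all sizes);
CMP **109** (1987) 249–301 [Balaban1987RG1] ((0.1)–(0.3) pp.251–252 — the tori `T^{(j)}`, blocks, centres); CMP **95** (1984) 17–40 [Balaban1984PropagatorsI]
((1.109)–(1.110) p.35 — the circular distance `|y − y′|`).
-/

open scoped BigOperators

namespace Summit.QuantumFields.YangMills.Theorems.CoverSites

open Literature.MathematicalPhysics.QuantumFieldTheory.Balaban1983to89
open B5Eq118OneStroke (iterBlockOf iterBlockOf_zero iterBlockOf_succ)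
open B5Eq117TorusCarriers (Mk)
open B5Prop12FieldsLattice (distSite)
open T3ContinuumYM3Torus (T3Family)

variable (P : Params) (jc : ℕ)

/-! ## §1 The covering parameters -/

/-- **THE `L^{jc}`-FOLD COVER IN EVERY DIRECTION**: same dimension `d`, block size `L` and number of steps `K`; volume exponent `m + jc` (so `T^{(i)}` of the
cover has `2L^{m+jc+K−i}` sites per direction); an `abbrev`, so that `(cover P jc).d = P.d` etc. reduce at reducible transparency
(`Fin (cover P jc).d` and `Fin P.d` are interchangeable for `rw`∕`simp`). [cite: Balaban1987RG1, (0.1) p.251; Balaban1985Variational, (144) p.300] -/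
abbrev cover : Params := ⟨P.d, P.L, P.m + jc, P.K, P.hd, P.hL⟩

/-- the cover has the same dimension. [cite: Balaban1987RG1, (0.1) p.251] -/
@[simp] theorem cover_d : (cover P jc).d = P.d := rfl

/-- the cover has the same block size. [cite: Balaban1987RG1, (0.1) p.251] -/
@[simp] theorem cover_L : (cover P jc).L = P.L := rfl

/-- the cover's volume exponent is `m + jc`. [cite: Balaban1987RG1, (0.1) p.251] -/
@[simp] theorem cover_m : (cover P jc).m = P.m + jc := rfl

/-- the cover has the same number of renormalisation steps. [cite: Balaban1987RG1, (0.1) p.251] -/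
@[simp] theorem cover_K : (cover P jc).K = P.K := rfl

/-- the site counts unfolded: `2L^{m+jc+K−i}`. [cite: Balaban1987RG1, (0.1) p.251] -/
theorem sitesPerDir_cover (i : ℕ) : (cover P jc).sitesPerDir i = 2 * P.L ^ (P.m + jc + P.K - i) := rfl

/-- **`2L^{m+K−i} ∣ 2L^{m+jc+K−i}`** at EVERY level `i` (for `i > m + K` truncated subtraction makes both exponents what they are; divisibility still holds).
[folklore] -/
theorem sitesPerDir_dvd (i : ℕ) : P.sitesPerDir i ∣ (cover P jc).sitesPerDir i := by
  rw [sitesPerDir_cover]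
  unfold Params.sitesPerDir
  exact mul_dvd_mul_left 2 (pow_dvd_pow P.L (by omega))

/-- in the standing range the quotient is `L^{jc}`: `2L^{m+jc+K−i} = 2L^{m+K−i}·L^{jc}`. [folklore] -/
theorem sitesPerDir_cover_eq (i : ℕ) (hi : i ≤ P.m + P.K) : (cover P jc).sitesPerDir i = P.sitesPerDir i * P.L ^ jc := by
  rw [sitesPerDir_cover]
  unfold Params.sitesPerDir
  have : P.m + jc + P.K - i = (P.m + P.K - i) + jc := by omega
  rw [this, pow_add, mul_assoc]

/-- the cover is at least as large: `2L^{m+K−i} ≤ 2L^{m+jc+K−i}`. [folklore] -/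
theorem sitesPerDir_le (i : ℕ) : P.sitesPerDir i ≤ (cover P jc).sitesPerDir i :=
  Nat.le_of_dvd (Nat.pos_of_ne_zero ((cover P jc).sitesPerDir_ne_zero i)) (sitesPerDir_dvd P jc i)

/-! ## §2 The covering map on sites -/

/-- **THE COVERING MAP** `π : T̃^{(i)} → T^{(i)}` at level `i`: coordinatewise reduction `ZMod (2L^{m+jc+K−i}) → ZMod (2L^{m+K−i})` (a ring homomorphism in each
coordinate). [cite: Balaban1987RG1, (0.1) p.251] -/
def proj (i : ℕ) (x : Site (cover P jc) i) : Site P i :=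
  fun μ => ZMod.castHom (sitesPerDir_dvd P jc i) (ZMod (P.sitesPerDir i)) (x μ)

/-- `proj` unfolded at a coordinate. [folklore] -/
theorem proj_apply (i : ℕ) (x : Site (cover P jc) i) (μ : Fin P.d) :
    proj P jc i x μ = ZMod.castHom (sitesPerDir_dvd P jc i) (ZMod (P.sitesPerDir i)) (x μ) := rfl

/-- **values**: `(π x)_μ = x_μ mod 2L^{m+K−i}` on the canonical representatives. [folklore] -/
theorem val_proj (i : ℕ) (x : Site (cover P jc) i) (μ : Fin P.d) : (proj P jc i x μ).val = (x μ).val % P.sitesPerDir i := by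
  rw [proj_apply, ZMod.castHom_apply, ZMod.cast_eq_val, ZMod.val_natCast]

/-- values after division by a divisor `M` of the site count: `((π x)_μ / M) mod (N/M) = (x_μ / M) mod (N/M)` (block constancy of `π` for `M`-blocks).
[folklore] -/
theorem val_proj_div (i : ℕ) (x : Site (cover P jc) i) (μ : Fin P.d) (M : ℕ) (hM : M ∣ P.sitesPerDir i) :
    (proj P jc i x μ).val / M % (P.sitesPerDir i / M) = (x μ).val / M % (P.sitesPerDir i / M) := by
  obtain ⟨q, hq⟩ := hM
  rcases Nat.eq_zero_or_pos M with hM0 | hM0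
  · subst hM0; simp
  rw [val_proj, hq, Nat.mul_div_cancel_left q hM0, Nat.mod_mul_right_div_self, Nat.mod_mod]

/-- the image of a natural-number vector: `π (v mod Ñ) = v mod N`. [folklore] -/
theorem proj_natCast (i : ℕ) (v : Fin P.d → ℕ) :
    proj P jc i (fun μ => ((v μ : ℕ) : ZMod ((cover P jc).sitesPerDir i))) = fun μ => ((v μ : ℕ) : ZMod (P.sitesPerDir i)) := by
  funext μ
  rw [proj_apply, map_natCast]

/-- **`π` is onto** (lift a site by its canonical representatives). [folklore] -/
theorem proj_surjective (i : ℕ) : Function.Surjective (proj P jc i) := by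
  intro y
  refine ⟨fun μ => (((y μ).val : ℕ) : ZMod ((cover P jc).sitesPerDir i)), ?_⟩
  rw [proj_natCast]
  funext μ
  exact ZMod.natCast_zmod_val (y μ)

/-- `π 0 = 0`. [folklore] -/
@[simp] theorem proj_zero (i : ℕ) : proj P jc i (fun _ => 0) = fun _ => 0 := by
  funext μ; rw [proj_apply, map_zero]

/-! ## §3 `π` is a homomorphism of the lattice graph -/

/-- `π (x + e_μ) = π x + e_μ`. [cite: Balaban1987RG1, (0.1) p.251] -/
theorem proj_shift (i : ℕ) (x : Site (cover P jc) i) (μ : Fin P.d) : proj P jc i (x.shift μ) = (proj P jc i x).shift μ := by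
  funext ν
  show ZMod.castHom (sitesPerDir_dvd P jc i) (ZMod (P.sitesPerDir i)) (Function.update x μ (x μ + 1) ν) =
    Function.update (proj P jc i x) μ (proj P jc i x μ + 1) ν
  by_cases h : ν = μ
  · subst h
    rw [Function.update_self, Function.update_self, map_add, map_one, proj_apply]
  · rw [Function.update_of_ne h, Function.update_of_ne h, proj_apply]

/-- `π (x − e_μ) = π x − e_μ`. [cite: Balaban1987RG1, (0.1) p.251] -/
theorem proj_unshift (i : ℕ) (x : Site (cover P jc) i) (μ : Fin P.d) : proj P jc i (x.unshift μ) = (proj P jc i x).unshift μ := by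
  funext ν
  show ZMod.castHom (sitesPerDir_dvd P jc i) (ZMod (P.sitesPerDir i)) (Function.update x μ (x μ - 1) ν) =
    Function.update (proj P jc i x) μ (proj P jc i x μ - 1) ν
  by_cases h : ν = μ
  · subst h
    rw [Function.update_self, Function.update_self, map_sub, map_one, proj_apply]
  · rw [Function.update_of_ne h, Function.update_of_ne h, proj_apply]

/-- `π` is additive coordinatewise. [folklore] -/
theorem proj_add (i : ℕ) (x t : Site (cover P jc) i) : proj P jc i (fun μ => x μ + t μ) = fun μ => proj P jc i x μ + proj P jc i t μ := by
  funext μ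
  rw [proj_apply, map_add, proj_apply, proj_apply]

/-- **DECK TRANSLATIONS**: adding a vector of the kernel of `π` does not change the image. [folklore] -/
theorem proj_add_ker (i : ℕ) (x t : Site (cover P jc) i) (ht : proj P jc i t = proj P jc i (fun _ => 0)) :
    proj P jc i (fun μ => x μ + t μ) = proj P jc i x := by
  rw [proj_add, ht, proj_zero]
  funext μ
  exact add_zero _

/-- the site count one level down is `L` times the next: `2L^{m+K−i} = L · 2L^{m+K−(i+1)}` for `i + 1 ≤ m + K`. [folklore] -/
theorem sitesPerDir_eq_mul_succ (i : ℕ) (hi : i + 1 ≤ P.m + P.K) : P.sitesPerDir i = P.L * P.sitesPerDir (i + 1) := by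
  unfold Params.sitesPerDir
  have : P.m + P.K - i = (P.m + P.K - (i + 1)) + 1 := by omega
  rw [this, pow_succ]
  ring

/-- **BLOCKS COMMUTE WITH `π`**: `π (B(x)) = B(π x)` — `((v mod 2L^{a+1}) / L) mod 2L^{a} = (v / L) mod 2L^{a}` because `2L^{a+1} = L·2L^{a}`.
Standing range `i + 1 ≤ m + K`. [cite: Balaban1987RG1, (0.3) p.252] -/
theorem proj_blockOf (i : ℕ) (hi : i + 1 ≤ P.m + P.K) (x : Site (cover P jc) i) :
    proj P jc (i + 1) (blockOf x) = blockOf (proj P jc i x) := by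
  funext μ
  rw [proj_apply]
  unfold blockOf
  rw [map_natCast, val_proj, sitesPerDir_eq_mul_succ P i hi, Nat.mod_mul_right_div_self, ZMod.natCast_mod]

/-- **BLOCK CENTRES COMMUTE WITH `π`**: `π (emb y) = emb (π y)` — `(yt mod 2L^{a})·L + (L−1)/2 ≡ yt·L + (L−1)/2 (mod L·2L^{a})`. Standing range `i + 1 ≤ m + K`.
[cite: Balaban1987RG1, (0.1) p.252] -/
theorem proj_emb (i : ℕ) (hi : i + 1 ≤ P.m + P.K) (y : Site (cover P jc) (i + 1)) :
    proj P jc i (emb y) = emb (proj P jc (i + 1) y) := by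
  funext μ
  rw [proj_apply]
  unfold emb
  rw [map_natCast, val_proj, ZMod.natCast_eq_natCast_iff, sitesPerDir_eq_mul_succ P i hi, mul_comm P.L]
  exact Nat.ModEq.add_right _ (Nat.ModEq.mul_right' _ (Nat.mod_modEq _ _)).symm

/-- **ITERATED BLOCKS COMMUTE WITH `π`**: `π (Bⁱ(x)) = Bⁱ(π x)` for `i ≤ m + K`. [cite: Balaban1987RG1, (0.3) p.252] -/
theorem proj_iterBlockOf : ∀ (i : ℕ), i ≤ P.m + P.K → ∀ x : Site (cover P jc) 0,
    proj P jc i (iterBlockOf i x) = iterBlockOf i (proj P jc 0 x)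
  | 0, _, x => by rw [iterBlockOf_zero, iterBlockOf_zero]
  | i + 1, hi, x => by
    rw [iterBlockOf_succ, iterBlockOf_succ, proj_blockOf P jc i hi, proj_iterBlockOf i (by omega) x]

/-- block membership is preserved: `x ∈ B(y) ⇒ π x ∈ B(π y)`. [cite: Balaban1987RG1, (0.3) p.252] -/
theorem mem_block_proj (i : ℕ) (hi : i + 1 ≤ P.m + P.K) (x : Site (cover P jc) i) (y : Site (cover P jc) (i + 1))
    (h : x ∈ block y) : proj P jc i x ∈ block (proj P jc (i + 1) y) := by
  simp only [block, Finset.mem_filter, Finset.mem_univ, true_and] at h ⊢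
  rw [← proj_blockOf P jc i hi, h]

/-! ## §4 Bonds and plaquettes -/

/-- **THE COVERING MAP ON BONDS**: `π⟨x, μ⟩ = ⟨π x, μ⟩`. [cite: Balaban1985Averaging, (5) p.18] -/
def projBond (i : ℕ) (b : PBond (cover P jc) i) : PBond P i := ⟨proj P jc i b.src, b.dir⟩

/-- the source of the projected bond. [folklore] -/
@[simp] theorem projBond_src (i : ℕ) (b : PBond (cover P jc) i) : (projBond P jc i b).src = proj P jc i b.src := rfl

/-- the direction of the projected bond. [folklore] -/
@[simp] theorem projBond_dir (i : ℕ) (b : PBond (cover P jc) i) : (projBond P jc i b).dir = b.dir := rfl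

/-- the target of the projected bond is the projection of the target. [folklore] -/
theorem projBond_tgt (i : ℕ) (b : PBond (cover P jc) i) : (projBond P jc i b).tgt = proj P jc i b.tgt := by
  simp only [PBond.tgt, projBond_src, projBond_dir, proj_shift]

/-- `π` is onto on bonds. [folklore] -/
theorem projBond_surjective (i : ℕ) : Function.Surjective (projBond P jc i) := by
  rintro ⟨x, μ⟩
  obtain ⟨xt, hxt⟩ := proj_surjective P jc i x
  exact ⟨⟨xt, μ⟩, by rw [projBond, hxt]⟩

/-- **THE COVERING MAP ON PLAQUETTES**: `π⟨x, μ, ν⟩ = ⟨π x, μ, ν⟩`. [cite: Balaban1985Averaging, (5) p.18] -/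
def projPlaq (i : ℕ) (p : Plaq (cover P jc) i) : Plaq P i := ⟨proj P jc i p.src, p.μ, p.ν, p.hμν⟩

/-- the source of the projected plaquette. [folklore] -/
@[simp] theorem projPlaq_src (i : ℕ) (p : Plaq (cover P jc) i) : (projPlaq P jc i p).src = proj P jc i p.src := rfl

/-! ## §5 Fibres: `K`-free cardinalities -/

/-- **ONE COORDINATE**: the fibre of the reduction `ZMod (N·L^{jc}) → ZMod N` over any residue has exactly `L^{jc}` elements (the lifts `c + N·q`, `q < L^{jc}`).
[folklore] -/
theorem card_fibre_coord (i : ℕ) (hi : i ≤ P.m + P.K) (c : ZMod (P.sitesPerDir i)) :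
    (Finset.univ.filter fun a : ZMod ((cover P jc).sitesPerDir i) =>
        ZMod.castHom (sitesPerDir_dvd P jc i) (ZMod (P.sitesPerDir i)) a = c).card = P.L ^ jc := by
  -- notation (no `set`: the statement keeps the literal moduli)
  let N := P.sitesPerDir i
  let N' := (cover P jc).sitesPerDir i
  have hNN' : N' = N * P.L ^ jc := sitesPerDir_cover_eq P jc i hi
  have hN0 : 0 < N := Nat.pos_of_ne_zero (P.sitesPerDir_ne_zero i)
  -- the lifts `q ↦ c.val + N·q`, `q < L^{jc}`
  let f : Fin (P.L ^ jc) → ZMod N' := fun q => ((c.val + N * (q : ℕ) : ℕ) : ZMod N')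
  have hlt : ∀ q : Fin (P.L ^ jc), c.val + N * (q : ℕ) < N' := fun q => by
    have hq := q.2
    have hc := c.val_lt
    calc c.val + N * (q : ℕ) < N + N * (q : ℕ) := by omega
      _ = N * ((q : ℕ) + 1) := by ring
      _ ≤ N * P.L ^ jc := Nat.mul_le_mul_left _ hq
      _ = N' := hNN'.symm
  have hfval : ∀ q : Fin (P.L ^ jc), (f q).val = c.val + N * (q : ℕ) := fun q => ZMod.val_natCast_of_lt (hlt q)
  have hfinj : Function.Injective f := by
    intro q q' h
    have := congrArg ZMod.val h
    rw [hfval, hfval] at this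
    exact Fin.ext (Nat.eq_of_mul_eq_mul_left hN0 (by omega))
  have hset : (Finset.univ.filter fun a : ZMod N' => ZMod.castHom (sitesPerDir_dvd P jc i) (ZMod N) a = c) = Finset.univ.image f := by
    ext a
    simp only [Finset.mem_filter, Finset.mem_univ, true_and, Finset.mem_image]
    constructor
    · intro ha
      -- `a = c.val + N·(a.val / N)` with `a.val / N < L^{jc}`
      have hval : a.val % N = c.val := by
        have := congrArg ZMod.val ha
        rwa [ZMod.castHom_apply, ZMod.cast_eq_val, ZMod.val_natCast] at this
      have hq : a.val / N < P.L ^ jc := by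
        rw [Nat.div_lt_iff_lt_mul hN0, mul_comm, ← hNN']; exact a.val_lt
      refine ⟨⟨a.val / N, hq⟩, ?_⟩
      show ((c.val + N * (a.val / N) : ℕ) : ZMod N') = a
      rw [← hval, Nat.mod_add_div, ZMod.natCast_zmod_val]
    · rintro ⟨q, rfl⟩
      show ZMod.castHom _ (ZMod N) (((c.val + N * (q : ℕ) : ℕ) : ZMod N')) = c
      rw [map_natCast, Nat.cast_add, Nat.cast_mul, ZMod.natCast_self, zero_mul, add_zero, ZMod.natCast_zmod_val]
  rw [hset, Finset.card_image_of_injective _ hfinj, Finset.card_univ, Fintype.card_fin]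

/-- ★ **SITE FIBRES**: every site of `T^{(i)}` has exactly `(L^{jc})^d` lifts (`i ≤ m + K`; the count is `K`-FREE). [folklore] -/
theorem card_fibre_site (i : ℕ) (hi : i ≤ P.m + P.K) (x : Site P i) :
    (Finset.univ.filter fun xt : Site (cover P jc) i => proj P jc i xt = x).card = (P.L ^ jc) ^ P.d := by
  -- the fibre is the product of the coordinate fibres
  let e : {xt : Site (cover P jc) i // proj P jc i xt = x} ≃
      ((μ : Fin P.d) → {a : ZMod ((cover P jc).sitesPerDir i) //
        ZMod.castHom (sitesPerDir_dvd P jc i) (ZMod (P.sitesPerDir i)) a = x μ}) :=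
    { toFun := fun v μ => ⟨v.1 μ, congrFun v.2 μ⟩
      invFun := fun g => ⟨fun μ => (g μ).1, funext fun μ => (g μ).2⟩
      left_inv := fun _ => rfl
      right_inv := fun _ => rfl }
  rw [← Fintype.card_subtype, Fintype.card_congr e, Fintype.card_pi]
  simp only [Fintype.card_subtype, card_fibre_coord P jc i hi, Finset.prod_const, Finset.card_univ, Fintype.card_fin]

section Bonds

/-- ★ **BOND FIBRES**: every bond of `T^{(i)}` has exactly `(L^{jc})^d` lifts (`i ≤ m + K`; the direction is carried along, so the fibre is the site fibre
of the source). [folklore] -/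
theorem card_fibre_bond (i : ℕ) [DecidableEq (PBond P i)] (hi : i ≤ P.m + P.K) (b : PBond P i) :
    (Finset.univ.filter fun bt : PBond (cover P jc) i => projBond P jc i bt = b).card = (P.L ^ jc) ^ P.d := by
  -- the bond fibre is the site fibre of the source (the direction is carried along)
  let e : {bt : PBond (cover P jc) i // projBond P jc i bt = b} ≃ {xt : Site (cover P jc) i // proj P jc i xt = b.src} :=
    { toFun := fun v => ⟨v.1.src, congrArg PBond.src v.2⟩
      invFun := fun u => ⟨⟨u.1, b.dir⟩, by rw [projBond, u.2]⟩
      left_inv := by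
        rintro ⟨⟨xt, μ⟩, hbt⟩
        have hμ : μ = b.dir := congrArg PBond.dir hbt
        subst hμ
        rfl
      right_inv := fun _ => rfl }
  rw [← Fintype.card_subtype, Fintype.card_congr e, Fintype.card_subtype, card_fibre_site P jc i hi]

/-- **SUMS OVER THE COVER REGROUP OVER FIBRES** (the letter-transfer workhorse of α5): `Σ_{bt} f bt = Σ_b Σ_{bt ∈ π⁻¹ b} f bt`. [folklore] -/
theorem sum_cover_eq_sum_fibre {M : Type*} [AddCommMonoid M] (i : ℕ) [DecidableEq (PBond P i)] (f : PBond (cover P jc) i → M) :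
    ∑ bt, f bt = ∑ b : PBond P i, ∑ bt ∈ Finset.univ.filter (fun bt => projBond P jc i bt = b), f bt :=
  (Finset.sum_fiberwise_of_maps_to (s := Finset.univ) (t := Finset.univ) (g := projBond P jc i) (fun _ _ => Finset.mem_univ _) f).symm

end Bonds

/-! ## §6 Distances: `π` shrinks the circular sup-distance, and the distance is attained on a lift -/

/-- one coordinate: reducing a residue can only shrink the absolute value of its minimal representative. [cite: Balaban1984PropagatorsI, (1.109) p.35] -/
theorem natAbs_valMinAbs_castHom_le {N N' : ℕ} [NeZero N] [NeZero N'] (h : N ∣ N') (a : ZMod N') :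
    (ZMod.castHom h (ZMod N) a).valMinAbs.natAbs ≤ a.valMinAbs.natAbs := by
  refine ZMod.natAbs_min_of_le_div_two N _ _ ?_ (ZMod.natAbs_valMinAbs_le _)
  rw [ZMod.coe_valMinAbs, ← map_intCast (ZMod.castHom h (ZMod N)) a.valMinAbs, ZMod.coe_valMinAbs]

/-- ★ **`π` CAN ONLY SHRINK THE CIRCULAR SUP-DISTANCE**: `|π x − π y| ≤ |x − y|`. [cite: Balaban1984PropagatorsI, (1.110) p.35] -/
theorem distSite_proj_le (i : ℕ) (x y : Site (cover P jc) i) :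
    distSite (Mk P i) (proj P jc i x) (proj P jc i y) ≤ distSite (Mk (cover P jc) i) x y := by
  unfold distSite
  exact_mod_cast Finset.sup_mono_fun fun μ _ => by
    rw [proj_apply, proj_apply, ← map_sub]
    exact natAbs_valMinAbs_castHom_le (sitesPerDir_dvd P jc i) (x μ - y μ)

/-- one coordinate: a SMALL integer keeps its absolute value as a residue of the (larger) cover modulus. [folklore] -/
theorem natAbs_valMinAbs_intCast_of_le {N' : ℕ} [NeZero N'] (r : ℤ) (hr : r.natAbs ≤ N' / 2) :
    ((r : ZMod N')).valMinAbs.natAbs = r.natAbs :=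
  le_antisymm (ZMod.natAbs_min_of_le_div_two N' _ _ (by rw [ZMod.coe_valMinAbs]) (ZMod.natAbs_valMinAbs_le _))
    (ZMod.natAbs_min_of_le_div_two N' _ _ (by rw [ZMod.coe_valMinAbs]) hr)

/-- ★ **THE DISTANCE DOWNSTAIRS IS ATTAINED ON A LIFT**: for every lift `xt` of a site and every site `y` downstairs there is a lift `yt` of `y` with
`|xt − yt| = |π xt − y|` (lift each coordinate by its minimal representative). [cite: Balaban1984PropagatorsI, (1.110) p.35] -/
theorem exists_lift_distSite_eq (i : ℕ) (xt : Site (cover P jc) i) (y : Site P i) :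
    ∃ yt : Site (cover P jc) i, proj P jc i yt = y ∧ distSite (Mk (cover P jc) i) xt yt = distSite (Mk P i) (proj P jc i xt) y := by
  -- the coordinate offsets downstairs, as minimal integers
  let r : Fin P.d → ℤ := fun μ => (proj P jc i xt μ - y μ).valMinAbs
  have hr : ∀ μ, ((r μ : ℤ) : ZMod (P.sitesPerDir i)) = proj P jc i xt μ - y μ := fun μ => ZMod.coe_valMinAbs _
  refine ⟨fun μ => xt μ - (r μ : ZMod ((cover P jc).sitesPerDir i)), ?_, ?_⟩
  · funext μ
    rw [proj_apply, map_sub, map_intCast, ← proj_apply, hr, sub_sub_cancel]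
  · unfold distSite
    refine congrArg (fun n : ℕ => (n : ℝ)) (Finset.sup_congr rfl fun μ _ => ?_)
    dsimp only
    rw [sub_sub_cancel]
    exact natAbs_valMinAbs_intCast_of_le (r μ) ((ZMod.natAbs_valMinAbs_le _).trans (Nat.div_le_div_right (sitesPerDir_le P jc i)))

/-! ## §7 The T³ reading: the cover of a member is a member with the same `L` -/

/-- **THE COVER OF A MEMBER**: same block size `L` (so the family index `Idx L` is closed under covering), volume exponent `m + jc`.
[cite: Balaban1985Variational, Thm 1 p.279, (144) p.300] -/
def _root_.Literature.MathematicalPhysics.QuantumFieldTheory.Balaban1983to89.T3ContinuumYM3Torus.T3Family.cover (F : T3Family) (jc : ℕ) : T3Family :=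
  ⟨F.L, F.hL, F.m + jc, le_trans F.hm (Nat.le_add_right _ _)⟩

/-- the `K`-th approximation of the cover IS the cover of the `K`-th approximation — definitionally. [cite: Balaban1985Variational, (144) p.300] -/
theorem T3Family.cover_P (F : T3Family) (jc K : ℕ) : (F.cover jc).P K = cover (F.P K) jc := rfl

/-- the cover of a member has the same block size. [cite: Balaban1985Variational, Thm 1 p.279] -/
@[simp] theorem T3Family.cover_L (F : T3Family) (jc : ℕ) : (F.cover jc).L = F.L := rfl

/-- the cover of a member has volume exponent `m + jc`. [cite: Balaban1985Variational, (144) p.300] -/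
@[simp] theorem T3Family.cover_m (F : T3Family) (jc : ℕ) : (F.cover jc).m = F.m + jc := rfl

end Summit.QuantumFields.YangMills.Theorems.CoverSites
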